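/-
Copyright: statement-level skeleton of a published paper (lit-balaban cell, Phase-2 proof seat p19, gen 4). No claims beyond
what the kernel checks below.
-/
import Mathlib
import Literature.MathematicalPhysics.QuantumFieldTheory.Balaban1983to89.B3Prop21Except24
import Literature.MathematicalPhysics.QuantumFieldTheory.Balaban1983to89.B3Prop21Except24Member

/-!
# B3 — T. Bałaban, *(Higgs)₂,₃ quantum fields in a finite volume. III. Renormalization*, CMP **88** (1983) 411–445
[Balaban1983Higgs3] — Proposition 2.1 p. 424 APPLIED TO THE GRAPH (2.4): (1.33) for the amplitudes of (2.4)

statement-level skeleton of published theorems with citation tags; proofs where landed; nothing here is a claim about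
the Yang–Mills mass gap

PDF held: `paper:balaban1983-higgs-2-3-quantum-fields-finite-volume` (journal page = PDF page + 410).

Part of the Phase-2 work on SKELETON rows **B3.Prop2.1 / B3.Prop2.2** (unit `lit-balaban-p19` gen 4, HOME
`run/shared/lean/pub/lit-balaban/`): the last worked instance of the (2.4) EXCEPTION files, combining
`B3Prop21Except24.prop21_except24` with `B3Prop21Except24Member.posSubgraphsExcept24_member24`.

WHAT IS REPRODUCED.  Proposition 2.1 p. 424 [PDF 14], verbatim: *"Let G be a connected graph such that its each connected
subgraph, with the possible exception of the subgraphs (2.4), has a positive degree. Then we define G_ren = {G} and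
Proposition 1 holds in this case."* — read for `G` = the graph (2.4) itself (its only connected subgraph IS (2.4), of degree `0`).
KERNEL-CHECKED HERE: **`ineq133At_member24`** — in the quantifier shape of Proposition 1 (δ₀ first, then O(1)(n̄) after α₀, n̄),
(1.33) holds for the class `{(2.4)}` of the family `famIBP (params24 Cmax CD) mbar`, i.e. for EVERY IBP-ready amplitude datum over
(2.4) (vertex functions, kernels obeying (2.10)–(2.12) with constants `≤ Cmax`, `cD ≤ CD`), all localizations `{□(v)}` and all
external fields: `|E((2.4), {□(v)}, Φ, A)| ≤ O(1) e(L^kε)^{d_v} λ(L^kε)^{d_s} exp[−δ₀ d({□(v)})] Π‖hΦ‖ Π‖h′A‖` with the same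
`δ₀` and `O(1)(n̄)` as for every other graph of the family (those of `prop21_except24`: `½δ₁` and `unifO1x`) — the case the
exception-free instances `B3Prop21Instance` / `B3Prop21Uniform` (`Is24 := False`) cannot reach (`not_posSubgraphs_member24`).
-/

open Finset

namespace Literature.MathematicalPhysics.QuantumFieldTheory.Balaban1983to89.B3Ineq213

open B3Ineq215 B3Sect2FirstEstimate B3Prop1

/-- **(1.33) for the amplitudes of the graph (2.4)**, from `prop21_except24` through the exception clause
(`posSubgraphsExcept24_member24`), in the quantifier shape of Proposition 1. [cite: Balaban1983Higgs3, Prop. 2.1 p.424] -/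
theorem ineq133At_member24 (Cmax CD : ℝ) (mbar : ℕ → ℕ) :
    ∃ δ₀ : ℝ, 0 < δ₀ ∧ ∀ α₀ : ℝ, 0 < α₀ → α₀ < 1 → ∀ nbar : ℕ, ∃ C : ℝ, 0 < C ∧
      ∀ (D : DatumIBP (params24 Cmax CD)) (h : 1 ≤ mbar nbar),
        Ineq133At (famIBP (params24 Cmax CD) mbar nbar D).toExpansion (member24 Cmax CD h) α₀ δ₀ C := by
  obtain ⟨δ₀, hδ, H⟩ := prop21_except24 (params24 Cmax CD) mbar
  refine ⟨δ₀, hδ, fun α₀ h0 h1 nbar => ?_⟩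
  obtain ⟨C, hC, HC⟩ := H α₀ h0 h1 nbar
  exact ⟨C, hC, fun D h => HC D (member24 Cmax CD h) (posSubgraphsExcept24_member24 Cmax CD h D)⟩

end Literature.MathematicalPhysics.QuantumFieldTheory.Balaban1983to89.B3Ineq213
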